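import Mathlib
import HarnessLib

/-!
# Route `UnitScaleTilt`, crux K1 «MinimiserStabilityRegPr» (stmt-QuantumFields-19200), route-R E′ growth side, ℛ-line, J-ROW★ curved — brick B-J1 «TENT-GRAM COERCIVITY»:
# `Σ_{r<ℓ} ‖(r+1)·A + (ℓ−1−r)·B‖² ≥ ℓ(ℓ+1)(ℓ+2)∕6·‖A‖² + ℓ(ℓ−1)(ℓ−2)∕6·‖B‖²` in any real inner-product space — the two tent profiles of a block are uniformly non-parallel
# (Gram matrix `ℓ³·[[⅓,⅙],[⅙,⅓]] + O(ℓ²)`), so the block mass of a tent field `(r+1)A + (ℓ−1−r)B` controls BOTH endpoint coefficients, with no alignment hypothesis on `A, B`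

Cell `ym3-torus`, width seat `ym-ust-19200-w4` (gen 7); LOCATE v4 (HOME `ym-ust-19200-w4/g7/LOCATE-JROW-CURVED-V4-w4g7.md`, 19200 evidence) step (e).  WHERE IT SITS: at an
R2-critical background the lattice current is a covariant tent of the coarse multiplier, `J⟨x,μ⟩ = ℓ^{−(d+1)}[(r_μ(x)+1)·λ̃_y + (ℓ−1−r_μ(x))·λ̃_{y−e_μ}]` per k-block (weak E–L
✓ `exists_multiplier_field_weakEL` + the straight-average transpose); this brick, read with `A = [λ̃_y; m]`, `B = [λ̃_{y−e_μ}; m]`, bounds the multiplier commutators by the block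
mass of `[J; m]`, whence (LOCATE v4 (f), triangle inequality only) `Σ|[curl_W J; m]|² ≤ (c∕ℓ²)·Σ|[J; m]|²` — the `ℓ⁻²` of J-ROW★ without Fourier analysis or an alignment row.
THEOREMS ONLY (0 `def`, 0 `sorry`); `--supports stmt-QuantumFields-19200`, count-neutral.  YM₃ on T³ is a ladder rung (R3), not the Clay problem; nothing here claims J-ROW★,
hKg-K, S3, E′, a stub, the crux, d = 4 or the mass gap.

WHAT IS PROVED (ns `…Theorems.Prop7TentGramCoercivity`).
* §1 `sum_range_add_one`, `sum_range_add_one_sq`, `sum_range_cast`, `sum_range_cast_sq`, ★ `sum_range_tent_diag_sub_cross(')` — the Faulhaber sums: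
  `Σ_{r<ℓ}(r+1)((r+1) − (ℓ−1−r)) = ℓ(ℓ+1)(ℓ+2)∕6`, `Σ_{r<ℓ}(ℓ−1−r)((ℓ−1−r) − (r+1)) = ℓ(ℓ−1)(ℓ−2)∕6`.
* §2 ★ `norm_sq_tent_ge` — per site: `‖aA + bB‖² ≥ a²‖A‖² + b²‖B‖² − ab(‖A‖² + ‖B‖²)` for `0 ≤ ab`;
  ★★★ `tent_gram_coercive (A B : E) (ℓ : ℕ) : ℓ(ℓ+1)(ℓ+2)∕6·‖A‖² + ℓ(ℓ−1)(ℓ−2)∕6·‖B‖² ≤ Σ_{r<ℓ} ‖(r+1)•A + (ℓ−1−r)•B‖²` (real inner-product space `E`),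
  `tent_gram_coercive'` (symmetric crude form, coefficient `ℓ(ℓ−1)(ℓ−2)∕6`);
  ★★ `tent_gram_coercive_hs` — the same for `X Y : M_N(ℂ)` in the Hilbert–Schmidt letters `Σ_jk‖·‖²` of ✓ `Prop7TracePairing` (entrywise, `E := ℂ`).
HONEST SCOPE.  Finite sums and the Cauchy–Schwarz inequality; nothing lattice- or gauge-specific.

References: T. Bałaban, CMP 95 (1984) 17–40 [Balaban1984PropagatorsI] ((1.18)–(1.20) pp.19–20: the straight block average and its transpose); CMP 102 (1985) 277–309
[Balaban1985Variational] (Prop. 7 p.299).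
-/

set_option autoImplicit false

noncomputable section

open scoped BigOperators RealInnerProductSpace

namespace Summit.QuantumFields.YangMills.Theorems.Prop7TentGramCoercivity

/-! ## §1 Faulhaber sums of the two tent profiles -/

/-- `Σ_{r<ℓ}(r+1) = ℓ(ℓ+1)∕2`. [folklore] -/
theorem sum_range_add_one (ℓ : ℕ) : ∑ r ∈ Finset.range ℓ, ((r : ℝ) + 1) = (ℓ : ℝ) * (ℓ + 1) / 2 := by
  induction ℓ with
  | zero => simp
  | succ n ih => rw [Finset.sum_range_succ, ih]; push_cast; ring

/-- `Σ_{r<ℓ}(r+1)² = ℓ(ℓ+1)(2ℓ+1)∕6`. [folklore] -/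
theorem sum_range_add_one_sq (ℓ : ℕ) : ∑ r ∈ Finset.range ℓ, ((r : ℝ) + 1) ^ 2 = (ℓ : ℝ) * (ℓ + 1) * (2 * ℓ + 1) / 6 := by
  induction ℓ with
  | zero => simp
  | succ n ih => rw [Finset.sum_range_succ, ih]; push_cast; ring

/-- ★ **DIAGONAL MINUS CROSS GRAM ENTRY OF THE TENT PROFILES**: `Σ_{r<ℓ}((r+1)² − (r+1)(ℓ−1−r)) = ℓ(ℓ+1)(ℓ+2)∕6`. [folklore] -/
theorem sum_range_tent_diag_sub_cross (ℓ : ℕ) :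
    ∑ r ∈ Finset.range ℓ, (((r : ℝ) + 1) ^ 2 - ((r : ℝ) + 1) * ((ℓ : ℝ) - 1 - r)) = (ℓ : ℝ) * (ℓ + 1) * (ℓ + 2) / 6 := by
  have e : ∀ r : ℕ, ((r : ℝ) + 1) ^ 2 - ((r : ℝ) + 1) * ((ℓ : ℝ) - 1 - r) = 2 * ((r : ℝ) + 1) ^ 2 - (ℓ : ℝ) * ((r : ℝ) + 1) := fun r => by ring
  simp_rw [e, Finset.sum_sub_distrib, ← Finset.mul_sum, sum_range_add_one, sum_range_add_one_sq]
  ring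

/-- `Σ_{r<ℓ} r = ℓ(ℓ−1)∕2`. [folklore] -/
theorem sum_range_cast (ℓ : ℕ) : ∑ r ∈ Finset.range ℓ, (r : ℝ) = (ℓ : ℝ) * (ℓ - 1) / 2 := by
  induction ℓ with
  | zero => simp
  | succ n ih => rw [Finset.sum_range_succ, ih]; push_cast; ring

/-- `Σ_{r<ℓ} r² = ℓ(ℓ−1)(2ℓ−1)∕6`. [folklore] -/
theorem sum_range_cast_sq (ℓ : ℕ) : ∑ r ∈ Finset.range ℓ, (r : ℝ) ^ 2 = (ℓ : ℝ) * (ℓ - 1) * (2 * ℓ - 1) / 6 := by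
  induction ℓ with
  | zero => simp
  | succ n ih => rw [Finset.sum_range_succ, ih]; push_cast; ring

/-- the second profile: `Σ_{r<ℓ}((ℓ−1−r)² − (r+1)(ℓ−1−r)) = ℓ(ℓ−1)(ℓ−2)∕6` (the two tent profiles `r+1`, `ℓ−1−r` are not mirror images; the lower endpoint gets the smaller Gram
margin). [folklore] -/
theorem sum_range_tent_diag_sub_cross' (ℓ : ℕ) :
    ∑ r ∈ Finset.range ℓ, ((((ℓ : ℝ) - 1 - r)) ^ 2 - ((r : ℝ) + 1) * ((ℓ : ℝ) - 1 - r)) = (ℓ : ℝ) * (ℓ - 1) * (ℓ - 2) / 6 := by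
  have e : ∀ r : ℕ, (((ℓ : ℝ) - 1 - r)) ^ 2 - ((r : ℝ) + 1) * ((ℓ : ℝ) - 1 - r)
      = ((ℓ : ℝ) - 1) * ((ℓ : ℝ) - 2) - (3 * (ℓ : ℝ) - 4) * (r : ℝ) + 2 * (r : ℝ) ^ 2 := fun r => by ring
  simp_rw [e, Finset.sum_add_distrib, Finset.sum_sub_distrib, ← Finset.mul_sum, sum_range_cast, sum_range_cast_sq, Finset.sum_const, Finset.card_range,
    nsmul_eq_mul]
  ring

/-! ## §2 The coercivity -/

section IPS

variable {E : Type*} [NormedAddCommGroup E] [InnerProductSpace ℝ E]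

/-- ★ **PER-SITE LOWER BOUND**: for `0 ≤ ab`, `‖aA + bB‖² ≥ a²‖A‖² + b²‖B‖² − ab·(‖A‖² + ‖B‖²)` (expand, `2⟪A,B⟫ ≥ −‖A‖² − ‖B‖²`). [folklore] -/
theorem norm_sq_tent_ge (A B : E) {a b : ℝ} (hab : 0 ≤ a * b) :
    a ^ 2 * ‖A‖ ^ 2 + b ^ 2 * ‖B‖ ^ 2 - a * b * (‖A‖ ^ 2 + ‖B‖ ^ 2) ≤ ‖a • A + b • B‖ ^ 2 := by
  rw [norm_add_sq_real, norm_smul, norm_smul, real_inner_smul_left, real_inner_smul_right, Real.norm_eq_abs, Real.norm_eq_abs,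
    mul_pow, mul_pow, sq_abs, sq_abs]
  have hi : |⟪A, B⟫| ≤ ‖A‖ * ‖B‖ := abs_real_inner_le_norm A B
  have h2 : -(‖A‖ ^ 2 + ‖B‖ ^ 2) ≤ 2 * ⟪A, B⟫ := by
    have := neg_abs_le ⟪A, B⟫
    nlinarith [sq_nonneg (‖A‖ - ‖B‖), norm_nonneg A, norm_nonneg B]
  nlinarith [h2, hab]

/-- ★★★ **TENT-GRAM COERCIVITY**: in a real inner-product space, for all `A B` and `ℓ`,
`ℓ(ℓ+1)(ℓ+2)∕6·‖A‖² + ℓ(ℓ−1)(ℓ−2)∕6·‖B‖² ≤ Σ_{r<ℓ} ‖(r+1)•A + (ℓ−1−r)•B‖²` — the block mass of a tent field dominates both endpoint coefficients (each `≳ ℓ³∕6`),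
uniformly, with no hypothesis relating `A` and `B`. [cite: Balaban1984PropagatorsI, (1.18)-(1.20) pp.19-20] -/
theorem tent_gram_coercive (A B : E) (ℓ : ℕ) :
    (ℓ : ℝ) * (ℓ + 1) * (ℓ + 2) / 6 * ‖A‖ ^ 2 + (ℓ : ℝ) * (ℓ - 1) * (ℓ - 2) / 6 * ‖B‖ ^ 2
      ≤ ∑ r ∈ Finset.range ℓ, ‖((r : ℝ) + 1) • A + ((ℓ : ℝ) - 1 - r) • B‖ ^ 2 := by
  have hpt : ∀ r ∈ Finset.range ℓ,
      ((r : ℝ) + 1) ^ 2 * ‖A‖ ^ 2 + ((ℓ : ℝ) - 1 - r) ^ 2 * ‖B‖ ^ 2 - ((r : ℝ) + 1) * ((ℓ : ℝ) - 1 - r) * (‖A‖ ^ 2 + ‖B‖ ^ 2)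
        ≤ ‖((r : ℝ) + 1) • A + ((ℓ : ℝ) - 1 - r) • B‖ ^ 2 := by
    intro r hr
    have hr' : r < ℓ := Finset.mem_range.mp hr
    refine norm_sq_tent_ge A B (mul_nonneg (by positivity) ?_)
    have : (r : ℝ) + 1 ≤ ℓ := by exact_mod_cast hr'
    linarith
  refine le_trans (le_of_eq ?_) (Finset.sum_le_sum hpt)
  have e : ∀ r : ℕ, ((r : ℝ) + 1) ^ 2 * ‖A‖ ^ 2 + ((ℓ : ℝ) - 1 - r) ^ 2 * ‖B‖ ^ 2 - ((r : ℝ) + 1) * ((ℓ : ℝ) - 1 - r) * (‖A‖ ^ 2 + ‖B‖ ^ 2)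
      = (((r : ℝ) + 1) ^ 2 - ((r : ℝ) + 1) * ((ℓ : ℝ) - 1 - r)) * ‖A‖ ^ 2
        + ((((ℓ : ℝ) - 1 - r)) ^ 2 - ((r : ℝ) + 1) * ((ℓ : ℝ) - 1 - r)) * ‖B‖ ^ 2 := fun r => by ring
  simp_rw [e, Finset.sum_add_distrib, ← Finset.sum_mul, sum_range_tent_diag_sub_cross, sum_range_tent_diag_sub_cross']

/-- the crude symmetric form: `ℓ(ℓ−1)(ℓ−2)∕6·(‖A‖² + ‖B‖²) ≤ Σ_{r<ℓ} ‖(r+1)•A + (ℓ−1−r)•B‖²` (`ℓ(ℓ−1)(ℓ−2) ≥ 0` on ℕ; `≥ ℓ³∕27·…` for `ℓ ≥ 3`, `∼ ℓ³∕6`). [folklore] -/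
theorem tent_gram_coercive' (A B : E) (ℓ : ℕ) :
    (ℓ : ℝ) * (ℓ - 1) * (ℓ - 2) / 6 * (‖A‖ ^ 2 + ‖B‖ ^ 2) ≤ ∑ r ∈ Finset.range ℓ, ‖((r : ℝ) + 1) • A + ((ℓ : ℝ) - 1 - r) • B‖ ^ 2 := by
  refine le_trans ?_ (tent_gram_coercive A B ℓ)
  have hℓ : (0 : ℝ) ≤ ℓ := Nat.cast_nonneg ℓ
  have hA : 0 ≤ ‖A‖ ^ 2 := by positivity
  have hmono : (ℓ : ℝ) * (ℓ - 1) * (ℓ - 2) / 6 ≤ (ℓ : ℝ) * (ℓ + 1) * (ℓ + 2) / 6 := by nlinarith [hℓ, sq_nonneg (ℓ : ℝ)]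
  nlinarith [mul_le_mul_of_nonneg_right hmono hA]

end IPS

/-! ## §3 The Hilbert–Schmidt reading on `M_N(ℂ)` -/

/-- ★★ **TENT-GRAM COERCIVITY, HILBERT–SCHMIDT LETTERS**: for `X Y : M_N(ℂ)` (real scalars acting entrywise),
`ℓ(ℓ−1)(ℓ−2)∕6·(Σ_jk‖X_jk‖² + Σ_jk‖Y_jk‖²) ≤ Σ_{r<ℓ} Σ_jk‖((r+1)•X + (ℓ−1−r)•Y)_jk‖²` — read with `X = [λ̃_y; m]`, `Y = [λ̃_{y−e_μ}; m]` it bounds the multiplier commutators of two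
adjacent coarse bonds by the block mass of the current commutator `[J; m]`. [cite: Balaban1984PropagatorsI, (1.18)-(1.20) pp.19-20; Balaban1985Variational, Prop. 7 p.299] -/
theorem tent_gram_coercive_hs {N : ℕ} (X Y : Matrix (Fin N) (Fin N) ℂ) (ℓ : ℕ) :
    (ℓ : ℝ) * (ℓ - 1) * (ℓ - 2) / 6 * (∑ j : Fin N, ∑ k : Fin N, ‖X j k‖ ^ 2 + ∑ j : Fin N, ∑ k : Fin N, ‖Y j k‖ ^ 2)
      ≤ ∑ r ∈ Finset.range ℓ, ∑ j : Fin N, ∑ k : Fin N, ‖((((r : ℝ) + 1) • X + ((ℓ : ℝ) - 1 - r) • Y) j k)‖ ^ 2 := by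
  have hpt : ∀ j k : Fin N, (ℓ : ℝ) * (ℓ - 1) * (ℓ - 2) / 6 * (‖X j k‖ ^ 2 + ‖Y j k‖ ^ 2)
      ≤ ∑ r ∈ Finset.range ℓ, ‖(((r : ℝ) + 1) • X + ((ℓ : ℝ) - 1 - r) • Y) j k‖ ^ 2 := by
    intro j k
    have h := tent_gram_coercive' (E := ℂ) (X j k) (Y j k) ℓ
    simpa only [Matrix.add_apply, Matrix.smul_apply] using h
  calc (ℓ : ℝ) * (ℓ - 1) * (ℓ - 2) / 6 * (∑ j : Fin N, ∑ k : Fin N, ‖X j k‖ ^ 2 + ∑ j : Fin N, ∑ k : Fin N, ‖Y j k‖ ^ 2)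
      = ∑ j : Fin N, ∑ k : Fin N, (ℓ : ℝ) * (ℓ - 1) * (ℓ - 2) / 6 * (‖X j k‖ ^ 2 + ‖Y j k‖ ^ 2) := by
        rw [← Finset.sum_add_distrib, Finset.mul_sum]
        refine Finset.sum_congr rfl fun j _ => ?_
        rw [← Finset.sum_add_distrib, Finset.mul_sum]
    _ ≤ ∑ j : Fin N, ∑ k : Fin N, ∑ r ∈ Finset.range ℓ, ‖(((r : ℝ) + 1) • X + ((ℓ : ℝ) - 1 - r) • Y) j k‖ ^ 2 :=
        Finset.sum_le_sum fun j _ => Finset.sum_le_sum fun k _ => hpt j k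
    _ = ∑ j : Fin N, ∑ r ∈ Finset.range ℓ, ∑ k : Fin N, ‖(((r : ℝ) + 1) • X + ((ℓ : ℝ) - 1 - r) • Y) j k‖ ^ 2 :=
        Finset.sum_congr rfl fun j _ => Finset.sum_comm
    _ = ∑ r ∈ Finset.range ℓ, ∑ j : Fin N, ∑ k : Fin N, ‖((((r : ℝ) + 1) • X + ((ℓ : ℝ) - 1 - r) • Y) j k)‖ ^ 2 := Finset.sum_comm

end Summit.QuantumFields.YangMills.Theorems.Prop7TentGramCoercivity

end
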